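import Summits.AtomisticToContinuum.BoseEinsteinCondensation.Theorems.LatticeODLROOffHalfFilling.Negative.OffHalfFillingForced

/-!
# Route `BECGroundStateSOS`, crux `LatticeODLROOffHalfFilling` (stmt-AtomisticToContinuum-11033),
# line `Sketch`: the registered stub `stub_trialEnergy`

Supports (does not close) stmt-AtomisticToContinuum-11033. The variational upper bound
`E₀(H_{L,μ}) ≤ −¾ L³` (`L ≥ 3`, every `μ`) for the crux Hamiltonian
`H_{L,μ} = −Σ_{⟨xy⟩}(S¹_xS¹_y + S²_xS²_y) − μ S³_tot` on the torus `(ℤ/Lℤ)³`.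

Proof: Rayleigh quotient of the constant vector `1` (the in-plane ferromagnetic product state
`|→→⋯→⟩` in the `S³` basis, unnormalised, `‖1‖² = 2^{L³}`). On a bond `x ≠ y`,
`⟨1, (S¹_xS¹_y + S²_xS²_y) 1⟩ = ½(⟨S⁻_x1, S⁻_y1⟩ + ⟨S⁺_x1, S⁺_y1⟩) = ½ #{σ : σ_x = σ_y}`, which is
`¼ · 2^{L³}` (the flip at `x` is a bijection `{σ_x = σ_y} ≃ {σ_x ≠ σ_y}`), so the kinetic term
contributes `−¾ L³ ‖1‖²` over the `3L³` bonds. The Zeeman term is dodged by the flip symmetry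
`E₀(H_{L,μ}) = E₀(H_{L,−μ})` (`flip_conj_hmu`, `groundEnergy_unitary_conj`): the two Rayleigh
bounds at `±μ` add up to `2E₀‖1‖² ≤ 2 · (−¾ L³)‖1‖²`.
-/

noncomputable section

namespace Summit.AtomisticToContinuum.BoseEinsteinCondensation.Theorems.LatticeODLROOffHalfFilling.Ladder

open Literature.MathematicalPhysics.QuantumLattice Literature.Probability.LatticeModels Matrix Finset
open Summit.AtomisticToContinuum.BoseEinsteinCondensation.Theorems.LatticeODLROOffHalfFilling.Negative
open scoped ComplexOrder BigOperators

variable {Λ : Type*} [Fintype Λ] [DecidableEq Λ]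

/-- `(S⁻_x 1)(σ) = [σ_x = ↓]` for the constant vector `1`. [folklore] -/
private theorem te_Ect_mulVec_one (x : Λ) (σ : TensorIndex Λ 2) :
    ((E x)ᴴ *ᵥ (1 : TensorIndex Λ 2 → ℂ)) σ = if σ x = 1 then 1 else 0 := by
  rw [E_conjTranspose, LiebMattis.onSite_mulVec_apply, Fin.sum_univ_two]
  simp only [Pi.one_apply, mul_one, conjTranspose_apply, raise]
  rcases Fin.exists_fin_two.mp ⟨σ x, rfl⟩ with h | h <;> simp [h]

/-- `(S⁺_x 1)(σ) = [σ_x = ↑]` for the constant vector `1`. [folklore] -/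
private theorem te_E_mulVec_one (x : Λ) (σ : TensorIndex Λ 2) :
    (E x *ᵥ (1 : TensorIndex Λ 2 → ℂ)) σ = if σ x = 0 then 1 else 0 := by
  rw [E_mulVec_apply, Pi.one_apply]

/-- `⟨1, AB 1⟩ = ⟨Aᴴ 1, B 1⟩`. [folklore] -/
private theorem te_quad_mul (A B : Op Λ 2) :
    star (1 : TensorIndex Λ 2 → ℂ) ⬝ᵥ (A * B) *ᵥ 1 = star (Aᴴ *ᵥ 1) ⬝ᵥ (B *ᵥ 1) := by
  rw [← mulVec_mulVec, dotProduct_mulVec, star_mulVec, conjTranspose_conjTranspose]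

/-- For `x ≠ y`, exactly half of all configurations `σ : Λ → Fin 2` agree at `x` and `y`
(the flip at `x` is a bijection onto the other half). [folklore] -/
private theorem te_count {x y : Λ} (hxy : x ≠ y) :
    2 * (∑ σ : TensorIndex Λ 2, if σ x = σ y then (1 : ℂ) else 0) =
      (Fintype.card (TensorIndex Λ 2) : ℂ) := by
  have hinv : Function.Involutive
      (fun σ : TensorIndex Λ 2 => Function.update σ x (Equiv.swap (0 : Fin 2) 1 (σ x))) := by
    intro σ
    simp only [Function.update_self, Equiv.swap_apply_self, Function.update_idem,
      Function.update_eq_self]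
  have hflip : (∑ σ : TensorIndex Λ 2, if σ x = σ y then (1 : ℂ) else 0) =
      ∑ σ : TensorIndex Λ 2, if σ x = σ y then (0 : ℂ) else 1 := by
    rw [← Equiv.sum_comp (hinv.toPerm _)
      (fun σ : TensorIndex Λ 2 => if σ x = σ y then (0 : ℂ) else 1)]
    refine Finset.sum_congr rfl fun σ _ => ?_
    simp only [Function.Involutive.coe_toPerm, Function.update_self,
      Function.update_of_ne (Ne.symm hxy)]
    rcases Fin.exists_fin_two.mp ⟨σ x, rfl⟩ with h | h <;>
      rcases Fin.exists_fin_two.mp ⟨σ y, rfl⟩ with h' | h' <;> simp [h, h']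
  have hsum : (∑ σ : TensorIndex Λ 2, if σ x = σ y then (1 : ℂ) else 0) +
      (∑ σ : TensorIndex Λ 2, if σ x = σ y then (0 : ℂ) else 1) =
      (Fintype.card (TensorIndex Λ 2) : ℂ) := by
    rw [← Finset.sum_add_distrib]
    rw [Finset.sum_congr rfl fun (σ : TensorIndex Λ 2) _ =>
      (show (if σ x = σ y then (1 : ℂ) else 0) + (if σ x = σ y then (0 : ℂ) else 1) = 1 by
        split_ifs <;> simp)]
    simp only [Finset.sum_const, Finset.card_univ, nsmul_eq_mul, mul_one]
  rw [two_mul]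
  nth_rewrite 2 [hflip]
  exact hsum

/-- **The bond expectation in the in-plane product state**:
`⟨1, (S¹_xS¹_y + S²_xS²_y) 1⟩ = #configurations / 4` for `x ≠ y`. [folklore] -/
private theorem te_bond {x y : Λ} (hxy : x ≠ y) :
    star (1 : TensorIndex Λ 2 → ℂ) ⬝ᵥ hop x y *ᵥ 1 =
      (Fintype.card (TensorIndex Λ 2) : ℂ) / 4 := by
  rw [hop_eq, smul_mulVec, dotProduct_smul, add_mulVec, dotProduct_add, te_quad_mul,
    te_quad_mul, conjTranspose_conjTranspose, smul_eq_mul]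
  have h : star ((E x)ᴴ *ᵥ (1 : TensorIndex Λ 2 → ℂ)) ⬝ᵥ ((E y)ᴴ *ᵥ 1) +
      star (E x *ᵥ (1 : TensorIndex Λ 2 → ℂ)) ⬝ᵥ (E y *ᵥ 1) =
      ∑ σ : TensorIndex Λ 2, if σ x = σ y then (1 : ℂ) else 0 := by
    simp only [dotProduct]
    rw [← Finset.sum_add_distrib]
    refine Finset.sum_congr rfl fun σ _ => ?_
    simp only [Pi.star_apply, te_Ect_mulVec_one, te_E_mulVec_one]
    rcases Fin.exists_fin_two.mp ⟨σ x, rfl⟩ with h | h <;>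
      rcases Fin.exists_fin_two.mp ⟨σ y, rfl⟩ with h' | h' <;> simp [h, h']
  rw [h, ← te_count hxy]
  ring

/-- **Trial energy.** `E₀(H_{L,μ}) ≤ −¾ L³` for every `μ` and `L ≥ 3`: the in-plane product state
(the constant vector in the `S³` basis) has `⟨hop_{xy}⟩ = ¼` on each of the `3L³` bonds and
`⟨S³_tot⟩ = 0`. [folklore] -/
theorem stub_trialEnergy (L : ℕ) [NeZero L] (hL : 3 ≤ L) (μ : ℝ) :
    (Hmu L μ).groundEnergy ≤ -(3 / 4 * (L : ℝ) ^ 3) := by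
  have hL2 : 2 ≤ L := by omega
  set w : TensorIndex (TorusSite 3 L) 2 → ℂ := 1 with hw
  set n : ℝ := (Fintype.card (TensorIndex (TorusSite 3 L) 2) : ℝ) with hn
  -- Rayleigh without normalisation: `E₀(K) ‖φ‖² ≤ Re⟨φ, Kφ⟩`
  have ray : ∀ K : Op (TorusSite 3 L) 2, K.IsHermitian →
      K.groundEnergy * (star w ⬝ᵥ w).re ≤ (star w ⬝ᵥ K *ᵥ w).re := by
    intro K hK
    have h := (posSemidef_sub_of_groundEnergy_le hK (le_refl _)).dotProduct_mulVec_nonneg w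
    rw [sub_mulVec, smul_mulVec, one_mulVec, dotProduct_sub, dotProduct_smul, smul_eq_mul] at h
    obtain ⟨hre, -⟩ := Complex.nonneg_iff.mp h
    rw [Complex.sub_re, Complex.re_ofReal_mul] at hre
    linarith
  -- the norm of the trial vector
  have hnorm : (star w ⬝ᵥ w).re = n := by
    rw [hw, star_one, one_dotProduct]
    simp only [Pi.one_apply, Finset.sum_const, Finset.card_univ, nsmul_eq_mul, mul_one,
      Complex.natCast_re, hn]
  have hnpos : 0 < n := by
    rw [hn]
    exact_mod_cast Fintype.card_pos
  -- the kinetic energy of the trial vector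
  have hcardΛ : Fintype.card (TorusSite 3 L) = L ^ 3 := by simp [ZMod.card, Fintype.card_fin]
  have hkin : star w ⬝ᵥ (xxzHamiltonian 1 (torusGraph 3 L) (-1) 0) *ᵥ w =
      ((-(3 / 4 * (L : ℝ) ^ 3 * n) : ℝ) : ℂ) := by
    have hb : ∀ (x : TorusSite 3 L) (i : Fin 3),
        star w ⬝ᵥ hop x (x + Pi.single i 1) *ᵥ w = (n : ℂ) / 4 := by
      intro x i
      have hne : x ≠ x + Pi.single i 1 := fun h =>
        torus_single_ne_zero hL2 i (left_eq_add.mp h)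
      rw [hw, te_bond hne, hn, Complex.ofReal_natCast]
    rw [xxz_eq L hL, Matrix.neg_mulVec, dotProduct_neg, Matrix.sum_mulVec, dotProduct_sum]
    simp_rw [Matrix.sum_mulVec, dotProduct_sum, hb]
    simp only [Finset.sum_const, Finset.card_univ, hcardΛ, Fintype.card_fin, nsmul_eq_mul]
    push_cast
    ring
  -- the quadratic form of `H_{L,ν}` on the trial vector
  have hquad : ∀ ν : ℝ, (star w ⬝ᵥ (Hmu L ν) *ᵥ w).re =
      -(3 / 4 * (L : ℝ) ^ 3 * n) -
        ν * (star w ⬝ᵥ (totalSpin 1 2 : Op (TorusSite 3 L) 2) *ᵥ w).re := by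
    intro ν
    rw [Hmu, sub_mulVec, smul_mulVec, dotProduct_sub, dotProduct_smul, smul_eq_mul,
      Complex.sub_re, Complex.re_ofReal_mul, hkin, Complex.ofReal_re]
  -- the flip symmetry `E₀(H_{L,−μ}) = E₀(H_{L,μ})`
  have hE : (Hmu L (-μ)).groundEnergy = (Hmu L μ).groundEnergy := by
    rw [← flip_conj_hmu L hL μ]
    refine groundEnergy_unitary_conj (Matrix.mem_unitaryGroup_iff.mpr ?_)
    rw [star_eq_conjTranspose]
    exact flipOp_mul_conjTranspose
  have h1 := ray (Hmu L μ) (Hmu_isHermitian L μ)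
  have h2 := ray (Hmu L (-μ)) (Hmu_isHermitian L (-μ))
  rw [hquad, hnorm] at h1 h2
  rw [hE] at h2
  have h3 : (Hmu L μ).groundEnergy * n ≤ -(3 / 4 * (L : ℝ) ^ 3) * n := by linarith
  exact le_of_mul_le_mul_right h3 hnpos

end Summit.AtomisticToContinuum.BoseEinsteinCondensation.Theorems.LatticeODLROOffHalfFilling.Ladder
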